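import Summits.NavierStokesRegularity.NavierStokesRegularity.Theorems.EfficiencyFloorNearMaximiserBoundedAmplificationUnitViscosity
import Summits.NavierStokesRegularity.NavierStokesRegularity.Theorems.EfficiencyFloorRigidExitReduction
import HarnessLib

/-!
# Route `EfficiencyFloor`, support `RigidExit` (stmt-25513) on the `ProductionEfficiencyDecay` ladder (stmt-22866):
# ITEM (ii) TYPED — `RigidExit` follows from an ORBITWISE uniform early deficit at viscosity `1`

Helper file (`--supports stmt-NavierStokesRegularity-22866`; line `efficiency_floor`), assembling the landed pieces of the
READING of `RigidExit` into ONE typed residue. After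

* `OrbitRate.earlyDeficit_everywhere_of_classification` (p838767): clause (a) ⟹ the early-deficit inequality at EVERY slice time,
  with a margin `θ = θ(u, s) > 0` depending on the slice (item (i), instant exit), and
* `nearMaximiserBoundedAmplification_iff_unitViscosity` (p838846): the pair `(A, ε)` of `NearMaximiserBoundedAmplification` is
  viscosity-free (reduction to `ν = 1`),

what item (ii) must supply is exactly UNIFORMITY of the margin near each maximiser ORBIT at `ν = 1`. This file proves the assembly:

* `nearMaximiserBoundedAmplification_of_orbitwiseEarlyDeficit` — IF at viscosity `1` the normalised maximisers are classified by
  finitely many representatives modulo the symmetry group (clause (a) of `MaximiserSetRigidity` at `ν = 1`, VERBATIM) AND every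
  normalised maximiser `m` at `ν = 1` admits ONE triple `(η, θ, ε)` (`0 ≤ η < 1`, `θ, ε > 0`) such that along every maximal classical
  Leray–Hopf rapidly-decaying-datum solution at viscosity `1`, every slice `u(s)` that is `ε`-close (scale-free `Ḣ¹∩Ḣ²`) to SOME
  point `l • R (m (l • R⁻¹(· − a)))` of the ORBIT of `m` is followed at `s' = s + η·W(s)` (`W(s) = (64/(27c⋆⁴))·Z(u s)⁻²`) by
  `s' < T` and the margin `(1 − η + 2θ)·Z(u s)⁻² ≤ Z(u s')⁻²` («ORBITWISE UNIFORM EARLY DEFICIT»), THEN the route decl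
  `NearMaximiserBoundedAmplification` holds (all viscosities): finitely many orbits ⟹ `ε = (1 + Σᵢ εᵢ⁻¹)⁻¹`,
  `A = 1 + Σᵢ √max((1−ηᵢ)⁻¹,(2θᵢ)⁻¹)`; the cubic law converts the one-instant margin into bounded amplification on the whole
  window (`sq_le_of_earlyDeficit`, p824714); `ν = 1` suffices by p838846.
* `rigidExit_of_orbitwiseEarlyDeficit` (BY NAME) — the orbitwise uniform early deficit at `ν = 1` ALONE implies the route decl
  `Theses.EfficiencyFloor.RigidExit` (clause (a) at `ν = 1` is supplied by its hypothesis `MaximiserSetRigidity`).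

READING (typed residue of stmt-25513): prove the orbitwise uniform early deficit at `ν = 1` — by p838767 the margin is positive at
every slice of every flow of the class, so what is missing is its lower semicontinuity/uniformity along slices approaching ONE
compact-modulo-symmetry orbit (continuous dependence of the enstrophy curve in `Ḣ¹∩Ḣ²` on the closed window fraction `[0, η·W]`,
plus a reference flow through the exact maximiser obeying the sharp budget). HONEST FRAMING: implications between OPEN statements
about a HYPOTHETICAL blow-up; `RigidExit`, `NearMaximiserBoundedAmplification`, clause (a), `LerayFloorGap`, `ProductionEfficiencyDecay`
(stmt-22866) and Navier–Stokes regularity stay OPEN; no summit statement is proved. [folklore]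
-/

-- the problem directory repeats the summit name (`NavierStokesRegularity/NavierStokesRegularity`)
set_option linter.dupNamespace false

noncomputable section

open Set Filter MeasureTheory Topology Function
open scoped InnerProductSpace RealInnerProductSpace ENNReal NNReal
open Literature.Analysis.FluidPDE

namespace Summit.NavierStokesRegularity.NavierStokesRegularity.Theorems

namespace NearMaximiserBoundedAmplification

open MaximiserSetRigidity.ProfileLiouville

/-- **Orbitwise uniform early deficit at `ν = 1` + classification at `ν = 1` ⟹ `NearMaximiserBoundedAmplification`.** [folklore] -/
theorem nearMaximiserBoundedAmplification_of_orbitwiseEarlyDeficit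
    (hA1 :
      ∀ c : ℝ, (0 < c ∧ (∀ v : EuclideanSpace ℝ (Fin 3) → EuclideanSpace ℝ (Fin 3), (ContDiff ℝ (⊤ : ℕ∞) v ∧
      Literature.Analysis.FluidPDE.VectorCalculus.IsDivFree v ∧ (∫⁻ x, ‖iteratedFDeriv ℝ 0 v x‖ₑ ^ 2 < ⊤) ∧ (∫⁻ x,
      ‖iteratedFDeriv ℝ 1 v x‖ₑ ^ 2 < ⊤) ∧ (∫⁻ x, ‖iteratedFDeriv ℝ 2 v x‖ₑ ^ 2 < ⊤)) → (∫ x,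
      ⟪Literature.Analysis.FluidPDE.curl v x, fderiv ℝ v x (Literature.Analysis.FluidPDE.curl v x)⟫_ℝ) ≤ c * (∫ x,
      ‖Literature.Analysis.FluidPDE.curl v x‖ ^ 2) ^ (3 / 4 : ℝ) * (∫ x, Literature.Analysis.FluidPDE.frobeniusNormSq
      (fderiv ℝ (Literature.Analysis.FluidPDE.curl v) x)) ^ (3 / 4 : ℝ)) ∧ ∀ c' : ℝ, (∀ w : EuclideanSpace ℝ (Fin 3) →
      EuclideanSpace ℝ (Fin 3), (ContDiff ℝ (⊤ : ℕ∞) w ∧ Literature.Analysis.FluidPDE.VectorCalculus.IsDivFree w ∧ (∫⁻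
      x, ‖iteratedFDeriv ℝ 0 w x‖ₑ ^ 2 < ⊤) ∧ (∫⁻ x, ‖iteratedFDeriv ℝ 1 w x‖ₑ ^ 2 < ⊤) ∧ (∫⁻ x, ‖iteratedFDeriv ℝ 2 w
      x‖ₑ ^ 2 < ⊤)) → (∫ x, ⟪Literature.Analysis.FluidPDE.curl w x, fderiv ℝ w x (Literature.Analysis.FluidPDE.curl w
      x)⟫_ℝ) ≤ c' * (∫ x, ‖Literature.Analysis.FluidPDE.curl w x‖ ^ 2) ^ (3 / 4 : ℝ) * (∫ x,
      Literature.Analysis.FluidPDE.frobeniusNormSq (fderiv ℝ (Literature.Analysis.FluidPDE.curl w) x)) ^ (3 / 4 : ℝ))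
      → c ≤ c') → ∃ (k : ℕ) (ms : Fin k → EuclideanSpace ℝ (Fin 3) → EuclideanSpace ℝ (Fin 3)), (∀ i, ((ContDiff ℝ (⊤
      : ℕ∞) (ms i) ∧ Literature.Analysis.FluidPDE.VectorCalculus.IsDivFree (ms i) ∧ (∫⁻ x, ‖iteratedFDeriv ℝ 0 (ms i)
      x‖ₑ ^ 2 < ⊤) ∧ (∫⁻ x, ‖iteratedFDeriv ℝ 1 (ms i) x‖ₑ ^ 2 < ⊤) ∧ (∫⁻ x, ‖iteratedFDeriv ℝ 2 (ms i) x‖ₑ ^ 2 < ⊤))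
      ∧ 0 < (∫ x, ‖Literature.Analysis.FluidPDE.curl (ms i) x‖ ^ 2) ∧ (∫ x, ⟪Literature.Analysis.FluidPDE.curl (ms i)
      x, fderiv ℝ (ms i) x (Literature.Analysis.FluidPDE.curl (ms i) x)⟫_ℝ) = c * (∫ x,
      ‖Literature.Analysis.FluidPDE.curl (ms i) x‖ ^ 2) ^ (3 / 4 : ℝ) * (∫ x,
      Literature.Analysis.FluidPDE.frobeniusNormSq (fderiv ℝ (Literature.Analysis.FluidPDE.curl (ms i)) x)) ^ (3 / 4 :
      ℝ) ∧ (∫ x, Literature.Analysis.FluidPDE.frobeniusNormSq (fderiv ℝ (Literature.Analysis.FluidPDE.curl (ms i)) x))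
      = 81 * c ^ 4 / (256 * 1 ^ 4) * (∫ x, ‖Literature.Analysis.FluidPDE.curl (ms i) x‖ ^ 2) ^ 3)) ∧ ∀ m :
      EuclideanSpace ℝ (Fin 3) → EuclideanSpace ℝ (Fin 3), ((ContDiff ℝ (⊤ : ℕ∞) m ∧
      Literature.Analysis.FluidPDE.VectorCalculus.IsDivFree m ∧ (∫⁻ x, ‖iteratedFDeriv ℝ 0 m x‖ₑ ^ 2 < ⊤) ∧ (∫⁻ x,
      ‖iteratedFDeriv ℝ 1 m x‖ₑ ^ 2 < ⊤) ∧ (∫⁻ x, ‖iteratedFDeriv ℝ 2 m x‖ₑ ^ 2 < ⊤)) ∧ 0 < (∫ x,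
      ‖Literature.Analysis.FluidPDE.curl m x‖ ^ 2) ∧ (∫ x, ⟪Literature.Analysis.FluidPDE.curl m x, fderiv ℝ m x
      (Literature.Analysis.FluidPDE.curl m x)⟫_ℝ) = c * (∫ x, ‖Literature.Analysis.FluidPDE.curl m x‖ ^ 2) ^ (3 / 4 :
      ℝ) * (∫ x, Literature.Analysis.FluidPDE.frobeniusNormSq (fderiv ℝ (Literature.Analysis.FluidPDE.curl m) x)) ^ (3
      / 4 : ℝ) ∧ (∫ x, Literature.Analysis.FluidPDE.frobeniusNormSq (fderiv ℝ (Literature.Analysis.FluidPDE.curl m)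
      x)) = 81 * c ^ 4 / (256 * 1 ^ 4) * (∫ x, ‖Literature.Analysis.FluidPDE.curl m x‖ ^ 2) ^ 3) → ∃ (i : Fin k) (a :
      EuclideanSpace ℝ (Fin 3)) (R : EuclideanSpace ℝ (Fin 3) ≃ₗᵢ[ℝ] EuclideanSpace ℝ (Fin 3)) (l : ℝ), 0 < l ∧ m =
      fun x => l • R (ms i (l • R.symm (x - a))))
    (hED :
      ∀ c : ℝ, (0 < c ∧ (∀ v : EuclideanSpace ℝ (Fin 3) → EuclideanSpace ℝ (Fin 3), (ContDiff ℝ (⊤ : ℕ∞) v ∧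
      Literature.Analysis.FluidPDE.VectorCalculus.IsDivFree v ∧ (∫⁻ x, ‖iteratedFDeriv ℝ 0 v x‖ₑ ^ 2 < ⊤) ∧ (∫⁻ x,
      ‖iteratedFDeriv ℝ 1 v x‖ₑ ^ 2 < ⊤) ∧ (∫⁻ x, ‖iteratedFDeriv ℝ 2 v x‖ₑ ^ 2 < ⊤)) → (∫ x,
      ⟪Literature.Analysis.FluidPDE.curl v x, fderiv ℝ v x (Literature.Analysis.FluidPDE.curl v x)⟫_ℝ) ≤ c * (∫ x,
      ‖Literature.Analysis.FluidPDE.curl v x‖ ^ 2) ^ (3 / 4 : ℝ) * (∫ x, Literature.Analysis.FluidPDE.frobeniusNormSq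
      (fderiv ℝ (Literature.Analysis.FluidPDE.curl v) x)) ^ (3 / 4 : ℝ)) ∧ ∀ c' : ℝ, (∀ w : EuclideanSpace ℝ (Fin 3) →
      EuclideanSpace ℝ (Fin 3), (ContDiff ℝ (⊤ : ℕ∞) w ∧ Literature.Analysis.FluidPDE.VectorCalculus.IsDivFree w ∧ (∫⁻
      x, ‖iteratedFDeriv ℝ 0 w x‖ₑ ^ 2 < ⊤) ∧ (∫⁻ x, ‖iteratedFDeriv ℝ 1 w x‖ₑ ^ 2 < ⊤) ∧ (∫⁻ x, ‖iteratedFDeriv ℝ 2 w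
      x‖ₑ ^ 2 < ⊤)) → (∫ x, ⟪Literature.Analysis.FluidPDE.curl w x, fderiv ℝ w x (Literature.Analysis.FluidPDE.curl w
      x)⟫_ℝ) ≤ c' * (∫ x, ‖Literature.Analysis.FluidPDE.curl w x‖ ^ 2) ^ (3 / 4 : ℝ) * (∫ x,
      Literature.Analysis.FluidPDE.frobeniusNormSq (fderiv ℝ (Literature.Analysis.FluidPDE.curl w) x)) ^ (3 / 4 : ℝ))
      → c ≤ c') → ∀ m : EuclideanSpace ℝ (Fin 3) → EuclideanSpace ℝ (Fin 3), ((ContDiff ℝ (⊤ : ℕ∞) m ∧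
      Literature.Analysis.FluidPDE.VectorCalculus.IsDivFree m ∧ (∫⁻ x, ‖iteratedFDeriv ℝ 0 m x‖ₑ ^ 2 < ⊤) ∧ (∫⁻ x,
      ‖iteratedFDeriv ℝ 1 m x‖ₑ ^ 2 < ⊤) ∧ (∫⁻ x, ‖iteratedFDeriv ℝ 2 m x‖ₑ ^ 2 < ⊤)) ∧ 0 < (∫ x,
      ‖Literature.Analysis.FluidPDE.curl m x‖ ^ 2) ∧ (∫ x, ⟪Literature.Analysis.FluidPDE.curl m x, fderiv ℝ m x
      (Literature.Analysis.FluidPDE.curl m x)⟫_ℝ) = c * (∫ x, ‖Literature.Analysis.FluidPDE.curl m x‖ ^ 2) ^ (3 / 4 :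
      ℝ) * (∫ x, Literature.Analysis.FluidPDE.frobeniusNormSq (fderiv ℝ (Literature.Analysis.FluidPDE.curl m) x)) ^ (3
      / 4 : ℝ) ∧ (∫ x, Literature.Analysis.FluidPDE.frobeniusNormSq (fderiv ℝ (Literature.Analysis.FluidPDE.curl m)
      x)) = 81 * c ^ 4 / (256 * 1 ^ 4) * (∫ x, ‖Literature.Analysis.FluidPDE.curl m x‖ ^ 2) ^ 3) → ∃ η θ ε : ℝ, 0 ≤ η
      ∧ η < 1 ∧ 0 < θ ∧ 0 < ε ∧ ∀ T : ℝ, 0 < T → ∀ (u : ℝ → EuclideanSpace ℝ (Fin 3) → EuclideanSpace ℝ (Fin 3)) (p :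
      ℝ → EuclideanSpace ℝ (Fin 3) → ℝ), Literature.Analysis.FluidPDE.IsMaximalSmoothSolution 1 0 u p T →
      Literature.Analysis.FluidPDE.IsLerayHopfOn T 1 0 (u 0) u → Literature.Analysis.FluidPDE.HasRapidSpatialDecay (u
      0) → ∀ s ∈ Set.Ioo 0 T, (∃ (a : EuclideanSpace ℝ (Fin 3)) (R : EuclideanSpace ℝ (Fin 3) ≃ₗᵢ[ℝ] EuclideanSpace ℝ
      (Fin 3)) (l : ℝ), 0 < l ∧ ((∫ x, ‖Literature.Analysis.FluidPDE.curl (u s - fun y => l • R (m (l • R.symm (y -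
      a)))) x‖ ^ 2) ≤ ε ^ 2 * (∫ x, ‖Literature.Analysis.FluidPDE.curl (u s) x‖ ^ 2) ∧ (∫ x,
      Literature.Analysis.FluidPDE.frobeniusNormSq (fderiv ℝ (Literature.Analysis.FluidPDE.curl (u s - fun y => l • R
      (m (l • R.symm (y - a))))) x)) ≤ ε ^ 2 * (∫ x, Literature.Analysis.FluidPDE.frobeniusNormSq (fderiv ℝ
      (Literature.Analysis.FluidPDE.curl (u s)) x)))) → s + η * (64 * 1 ^ 3 / (27 * c ^ 4) * (∫ x,
      ‖Literature.Analysis.FluidPDE.curl (u s) x‖ ^ 2)⁻¹ ^ 2) < T ∧ (1 - η + 2 * θ) * (∫ x,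
      ‖Literature.Analysis.FluidPDE.curl (u s) x‖ ^ 2)⁻¹ ^ 2 ≤ (∫ x, ‖Literature.Analysis.FluidPDE.curl (u (s + η *
      (64 * 1 ^ 3 / (27 * c ^ 4) * (∫ x, ‖Literature.Analysis.FluidPDE.curl (u s) x‖ ^ 2)⁻¹ ^ 2))) x‖ ^ 2)⁻¹ ^ 2) :
    Summit.NavierStokesRegularity.NavierStokesRegularity.Theses.EfficiencyFloor.NearMaximiserBoundedAmplification := by
  rw [nearMaximiserBoundedAmplification_iff_unitViscosity]
  intro c hsharp
  obtain ⟨k, ms, hms, hclass⟩ := hA1 c hsharp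
  -- one triple `(ηᵢ, θᵢ, εᵢ)` per representative
  choose η θ ε hη0 hη1 hθ hε hlaw using fun i => hED c hsharp (ms i) (hms i)
  -- aggregate constants over the finitely many orbits
  set Ai : Fin k → ℝ := fun i => Real.sqrt (max (1 - η i)⁻¹ (2 * θ i)⁻¹) with hAi
  set A : ℝ := 1 + ∑ i, Ai i with hA
  set ε₀ : ℝ := (1 + ∑ i, (ε i)⁻¹)⁻¹ with hε₀
  have hAi0 : ∀ i, 0 ≤ Ai i := fun i => Real.sqrt_nonneg _
  have hsumA : 0 ≤ ∑ i, Ai i := Finset.sum_nonneg fun i _ => hAi0 i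
  have hAone : 1 ≤ A := by rw [hA]; linarith
  have hAiA : ∀ i, Ai i ≤ A := fun i => by
    have h1 : Ai i ≤ ∑ j, Ai j := Finset.single_le_sum (f := Ai) (fun j _ => hAi0 j) (Finset.mem_univ i)
    rw [hA]; linarith
  have hsumε : 0 ≤ ∑ i, (ε i)⁻¹ := Finset.sum_nonneg fun i _ => (inv_pos.2 (hε i)).le
  have hε₀pos : 0 < ε₀ := by rw [hε₀]; exact inv_pos.2 (by linarith)
  have hε₀le : ∀ i, ε₀ ≤ ε i := fun i => by
    have h1 : (ε i)⁻¹ ≤ 1 + ∑ j, (ε j)⁻¹ := by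
      have h2 : (ε i)⁻¹ ≤ ∑ j, (ε j)⁻¹ :=
        Finset.single_le_sum (f := fun j => (ε j)⁻¹) (fun j _ => (inv_pos.2 (hε j)).le) (Finset.mem_univ i)
      linarith
    calc ε₀ = (1 + ∑ j, (ε j)⁻¹)⁻¹ := rfl
      _ ≤ ((ε i)⁻¹)⁻¹ := inv_anti₀ (inv_pos.2 (hε i)) h1
      _ = ε i := inv_inv _
  refine ⟨A, ε₀, hAone, hε₀pos, fun T hT u p hmax hLH hdec s hs m hm hclose t ht hwin => ?_⟩
  -- the maximiser lies in the orbit of some representative; closeness at tolerance `εᵢ`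
  obtain ⟨i, a, R, l, hl, hmrep⟩ := hclass m hm
  have hclose_i : ∃ (a : EuclideanSpace ℝ (Fin 3)) (R : EuclideanSpace ℝ (Fin 3) ≃ₗᵢ[ℝ] EuclideanSpace ℝ (Fin 3)) (l : ℝ),
      0 < l ∧ ((∫ x, ‖curl (u s - fun y => l • R (ms i (l • R.symm (y - a)))) x‖ ^ 2) ≤
        ε i ^ 2 * (∫ x, ‖curl (u s) x‖ ^ 2) ∧
      (∫ x, frobeniusNormSq (fderiv ℝ (curl (u s - fun y => l • R (ms i (l • R.symm (y - a))))) x)) ≤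
        ε i ^ 2 * (∫ x, frobeniusNormSq (fderiv ℝ (curl (u s)) x))) := by
    subst hmrep
    have hε2 : ε₀ ^ 2 ≤ ε i ^ 2 := pow_le_pow_left₀ hε₀pos.le (hε₀le i) 2
    refine ⟨a, R, l, hl, hclose.1.trans ?_, hclose.2.trans ?_⟩
    · exact mul_le_mul_of_nonneg_right hε2 (integral_nonneg fun _ => by positivity)
    · exact mul_le_mul_of_nonneg_right hε2 (integral_nonneg fun _ => frobeniusNormSq_nonneg _)
  obtain ⟨hs'T, hdef⟩ := hlaw i T hT u p hmax hLH hdec s hs hclose_i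
  -- the sharp cubic law along the flow at viscosity `1`
  obtain ⟨c₀, hsharp₀, hbud⟩ := efficiencyFloor_sharpLuDoeringBudget_proof
  have hcc : c₀ = c := sharp_const_unique hsharp₀ hsharp
  have hc : 0 < c := hsharp.1
  obtain ⟨Zr, D, hZD⟩ := hbud 1 T one_pos hT u p hmax hLH hdec
  set K : ℝ := 27 * c ^ 4 / (128 * 1 ^ 3) with hK
  have hKpos : 0 < K := by positivity
  have he : 64 * 1 ^ 3 / (27 * c ^ 4) = (2 * K)⁻¹ := by
    rw [hK]; field_simp; norm_num
  have hpos : ∀ τ ∈ Ico s T, 0 < Zr τ := fun τ hτ => by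
    have hτI : τ ∈ Ioo 0 T := ⟨hs.1.trans_le hτ.1, hτ.2⟩
    have h1 := lintegral_curl_sq_pos one_pos hT hmax hLH hdec τ ⟨hτI.1.le, hτI.2⟩
    rw [(hZD τ hτI).1] at h1
    exact ENNReal.ofReal_pos.1 h1
  have hder : ∀ τ ∈ Ico s T, ∃ D' : ℝ, HasDerivAt Zr D' τ ∧ D' ≤ K * Zr τ ^ 3 := fun τ hτ => by
    have hτI : τ ∈ Ioo 0 T := ⟨hs.1.trans_le hτ.1, hτ.2⟩
    refine ⟨D τ, (hZD τ hτI).2.2.2.2.1, ?_⟩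
    have h3 := (hZD τ hτI).2.2.2.2.2.2
    rw [hcc] at h3
    rw [hK]; exact h3
  have htI : t ∈ Ioo 0 T := ⟨hs.1.trans_le ht.1, ht.2⟩
  have hZs : (∫ x, ‖curl (u s) x‖ ^ 2) = Zr s := ((hZD s hs).2.2.2.1).symm
  have hZt : (∫ x, ‖curl (u t) x‖ ^ 2) = Zr t := ((hZD t htI).2.2.2.1).symm
  rw [hZs, he] at hwin hs'T hdef
  have hW0 : 0 ≤ η i * ((2 * K)⁻¹ * (Zr s)⁻¹ ^ 2) := by have := hη0 i; positivity
  have hs'I : s + η i * ((2 * K)⁻¹ * (Zr s)⁻¹ ^ 2) ∈ Ioo 0 T := ⟨by linarith [hs.1], hs'T⟩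
  have hZs' : (∫ x, ‖curl (u (s + η i * ((2 * K)⁻¹ * (Zr s)⁻¹ ^ 2))) x‖ ^ 2) =
      Zr (s + η i * ((2 * K)⁻¹ * (Zr s)⁻¹ ^ 2)) := ((hZD _ hs'I).2.2.2.1).symm
  rw [hZs'] at hdef
  rw [hZs, hZt]
  have hsq := sq_le_of_earlyDeficit hKpos (hη0 i) (hη1 i) (hθ i) hpos hder le_rfl hdef ht.1 ht.2 hwin
  -- `Zr t² ≤ Aᵢ² Zr s² ≤ (A Zr s)²`
  have h1η : 0 < 1 - η i := by linarith [hη1 i]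
  have hM0 : 0 ≤ max (1 - η i)⁻¹ (2 * θ i)⁻¹ := le_max_of_le_left (inv_nonneg.2 h1η.le)
  have hAi2 : Ai i ^ 2 = max (1 - η i)⁻¹ (2 * θ i)⁻¹ := by rw [hAi]; exact Real.sq_sqrt hM0
  rw [← hAi2, ← mul_pow] at hsq
  have hZt0 : 0 ≤ Zr t := (hpos t ⟨ht.1, ht.2⟩).le
  have hZs0 : 0 ≤ Zr s := (hpos s ⟨le_rfl, hs.2⟩).le
  have hAZ : 0 ≤ Ai i * Zr s := mul_nonneg (hAi0 i) hZs0
  calc Zr t ≤ Ai i * Zr s := (pow_le_pow_iff_left₀ hZt0 hAZ two_ne_zero).1 hsq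
    _ ≤ A * Zr s := mul_le_mul_of_nonneg_right (hAiA i) hZs0

/-- **`RigidExit` ⟸ the orbitwise uniform early deficit at viscosity `1`**, BY NAME against the route decl: clause (a) (the hypothesis
`MaximiserSetRigidity` of `RigidExit`) supplies the classification at `ν = 1`. [folklore] -/
theorem rigidExit_of_orbitwiseEarlyDeficit
    (hED :
      ∀ c : ℝ, (0 < c ∧ (∀ v : EuclideanSpace ℝ (Fin 3) → EuclideanSpace ℝ (Fin 3), (ContDiff ℝ (⊤ : ℕ∞) v ∧
      Literature.Analysis.FluidPDE.VectorCalculus.IsDivFree v ∧ (∫⁻ x, ‖iteratedFDeriv ℝ 0 v x‖ₑ ^ 2 < ⊤) ∧ (∫⁻ x,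
      ‖iteratedFDeriv ℝ 1 v x‖ₑ ^ 2 < ⊤) ∧ (∫⁻ x, ‖iteratedFDeriv ℝ 2 v x‖ₑ ^ 2 < ⊤)) → (∫ x,
      ⟪Literature.Analysis.FluidPDE.curl v x, fderiv ℝ v x (Literature.Analysis.FluidPDE.curl v x)⟫_ℝ) ≤ c * (∫ x,
      ‖Literature.Analysis.FluidPDE.curl v x‖ ^ 2) ^ (3 / 4 : ℝ) * (∫ x, Literature.Analysis.FluidPDE.frobeniusNormSq
      (fderiv ℝ (Literature.Analysis.FluidPDE.curl v) x)) ^ (3 / 4 : ℝ)) ∧ ∀ c' : ℝ, (∀ w : EuclideanSpace ℝ (Fin 3) →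
      EuclideanSpace ℝ (Fin 3), (ContDiff ℝ (⊤ : ℕ∞) w ∧ Literature.Analysis.FluidPDE.VectorCalculus.IsDivFree w ∧ (∫⁻
      x, ‖iteratedFDeriv ℝ 0 w x‖ₑ ^ 2 < ⊤) ∧ (∫⁻ x, ‖iteratedFDeriv ℝ 1 w x‖ₑ ^ 2 < ⊤) ∧ (∫⁻ x, ‖iteratedFDeriv ℝ 2 w
      x‖ₑ ^ 2 < ⊤)) → (∫ x, ⟪Literature.Analysis.FluidPDE.curl w x, fderiv ℝ w x (Literature.Analysis.FluidPDE.curl w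
      x)⟫_ℝ) ≤ c' * (∫ x, ‖Literature.Analysis.FluidPDE.curl w x‖ ^ 2) ^ (3 / 4 : ℝ) * (∫ x,
      Literature.Analysis.FluidPDE.frobeniusNormSq (fderiv ℝ (Literature.Analysis.FluidPDE.curl w) x)) ^ (3 / 4 : ℝ))
      → c ≤ c') → ∀ m : EuclideanSpace ℝ (Fin 3) → EuclideanSpace ℝ (Fin 3), ((ContDiff ℝ (⊤ : ℕ∞) m ∧
      Literature.Analysis.FluidPDE.VectorCalculus.IsDivFree m ∧ (∫⁻ x, ‖iteratedFDeriv ℝ 0 m x‖ₑ ^ 2 < ⊤) ∧ (∫⁻ x,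
      ‖iteratedFDeriv ℝ 1 m x‖ₑ ^ 2 < ⊤) ∧ (∫⁻ x, ‖iteratedFDeriv ℝ 2 m x‖ₑ ^ 2 < ⊤)) ∧ 0 < (∫ x,
      ‖Literature.Analysis.FluidPDE.curl m x‖ ^ 2) ∧ (∫ x, ⟪Literature.Analysis.FluidPDE.curl m x, fderiv ℝ m x
      (Literature.Analysis.FluidPDE.curl m x)⟫_ℝ) = c * (∫ x, ‖Literature.Analysis.FluidPDE.curl m x‖ ^ 2) ^ (3 / 4 :
      ℝ) * (∫ x, Literature.Analysis.FluidPDE.frobeniusNormSq (fderiv ℝ (Literature.Analysis.FluidPDE.curl m) x)) ^ (3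
      / 4 : ℝ) ∧ (∫ x, Literature.Analysis.FluidPDE.frobeniusNormSq (fderiv ℝ (Literature.Analysis.FluidPDE.curl m)
      x)) = 81 * c ^ 4 / (256 * 1 ^ 4) * (∫ x, ‖Literature.Analysis.FluidPDE.curl m x‖ ^ 2) ^ 3) → ∃ η θ ε : ℝ, 0 ≤ η
      ∧ η < 1 ∧ 0 < θ ∧ 0 < ε ∧ ∀ T : ℝ, 0 < T → ∀ (u : ℝ → EuclideanSpace ℝ (Fin 3) → EuclideanSpace ℝ (Fin 3)) (p :
      ℝ → EuclideanSpace ℝ (Fin 3) → ℝ), Literature.Analysis.FluidPDE.IsMaximalSmoothSolution 1 0 u p T →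
      Literature.Analysis.FluidPDE.IsLerayHopfOn T 1 0 (u 0) u → Literature.Analysis.FluidPDE.HasRapidSpatialDecay (u
      0) → ∀ s ∈ Set.Ioo 0 T, (∃ (a : EuclideanSpace ℝ (Fin 3)) (R : EuclideanSpace ℝ (Fin 3) ≃ₗᵢ[ℝ] EuclideanSpace ℝ
      (Fin 3)) (l : ℝ), 0 < l ∧ ((∫ x, ‖Literature.Analysis.FluidPDE.curl (u s - fun y => l • R (m (l • R.symm (y -
      a)))) x‖ ^ 2) ≤ ε ^ 2 * (∫ x, ‖Literature.Analysis.FluidPDE.curl (u s) x‖ ^ 2) ∧ (∫ x,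
      Literature.Analysis.FluidPDE.frobeniusNormSq (fderiv ℝ (Literature.Analysis.FluidPDE.curl (u s - fun y => l • R
      (m (l • R.symm (y - a))))) x)) ≤ ε ^ 2 * (∫ x, Literature.Analysis.FluidPDE.frobeniusNormSq (fderiv ℝ
      (Literature.Analysis.FluidPDE.curl (u s)) x)))) → s + η * (64 * 1 ^ 3 / (27 * c ^ 4) * (∫ x,
      ‖Literature.Analysis.FluidPDE.curl (u s) x‖ ^ 2)⁻¹ ^ 2) < T ∧ (1 - η + 2 * θ) * (∫ x,
      ‖Literature.Analysis.FluidPDE.curl (u s) x‖ ^ 2)⁻¹ ^ 2 ≤ (∫ x, ‖Literature.Analysis.FluidPDE.curl (u (s + η *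
      (64 * 1 ^ 3 / (27 * c ^ 4) * (∫ x, ‖Literature.Analysis.FluidPDE.curl (u s) x‖ ^ 2)⁻¹ ^ 2))) x‖ ^ 2)⁻¹ ^ 2) :
    Summit.NavierStokesRegularity.NavierStokesRegularity.Theses.EfficiencyFloor.RigidExit :=
  rigidExit_of_partA_imp fun hA =>
    nearMaximiserBoundedAmplification_of_orbitwiseEarlyDeficit (fun c hc => hA c 1 hc one_pos) hED

end NearMaximiserBoundedAmplification

end Summit.NavierStokesRegularity.NavierStokesRegularity.Theorems

end
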